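import Mathlib
import HarnessLib
import Literature.Analysis.ValidatedNumerics.SparsePolynomialEnclosure
import Literature.Analysis.Calculus.MvPolynomialFDeriv

/-!
# Route `PoloidalWindowDoor`, item `LrcModEntire` (stmt-NavierStokesRegularity-20428) — KERNEL-SIDE CHECKER FOR EXACT
# ELIMINATION CERTIFICATES: total derivatives of jet polynomials and the prolongation-certificate interpreter (Defs file)

Cell ns-regularity-ideate, seat ns-poloidal-K2-p3 gen 7 (lead of item 20428; `--supports stmt-NavierStokesRegularity-20428`; definitions
reviewed).  Generic calculus (no Navier–Stokes content): the object through which an INCONSISTENT verdict of the exact-elimination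
lanes (nsreg-p7 g10–g12 Janet/SLP engines, ns-poloidal-K2-p2 g6 evolution ranking, cert-1 jet schemes) on the registered local statement
`stub_localTHEmpty` (skeleton `Cruxes/LrcModEntire/Lines/twist_split.lean` v4; = the hypothesis `hempty` of
`…LrcModEntireTwistingTHLocal.stub_twistingTH_of_localEmpty`) becomes a kernel theorem: the engines export a law chain WITH COFACTORS,
`derive` replays it on term lists, `decide +kernel` checks the final syntactic identity, `cert_contradiction` concludes.

THE SETTING (differential algebra of jets, Ritt 1950 / Olver 1986 §2.3 «total derivative»).  A system of PDEs for unknown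
functions `u₁, …, u_m` of `x ∈ E` is studied through finitely many JET COORDINATES: a map `g : E → ℝⁿ` whose components are
the unknowns, their partial derivatives up to some order, and coefficient functions, so that every PDE of the system and every
differential consequence of bounded order is `P(g(x)) = 0` for a polynomial `P` in `n` letters.  Differentiating such an
identity along a direction `v` is again of this form provided the jet map is CLOSED under `∂_v` at the polynomial level: every
component satisfies `∂_v gₐ = Sₐ(g)` for some polynomial `Sₐ` (the «derivative table»; e.g. `∂_x(u_y) = u_{xy}` is a letter,
`∂_x Λ(z) = 0`, or a principal derivative replaced by its normal form).  Then
    `∂_v [P(g)] = (D_S P)(g)`,   `D_S P := Σₐ (∂P/∂Xₐ) · Sₐ`   — the TOTAL DERIVATIVE (chain rule).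
An ELIMINATION CERTIFICATE for «the system has no solution with `T(g(x₀)) ≠ 0`» is a finite list of steps, each producing a
new polynomial law as a polynomial-coefficient combination of iterated total derivatives of earlier laws; if some derived law
equals `T`, then `T(g) ≡ 0` on the domain — contradiction.  All steps are SYNTACTIC operations on sparse rational term lists
(`Literature.Analysis.ValidatedNumerics.QMvPoly`: `mul`, `pderivQ`, `normalize`), so a certificate is checked by `decide`.

* `ev n q z` — the value of the term list `q` at the jet point `z ∈ ℝⁿ` (`MvPoly.toFun ∘ QMvPoly.toMv`);
* `tderiv n S p` — the total derivative `D_S p`; `toMv_tderiv` (algebraic meaning);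
* `fderiv_ev_eq_ev_tderiv` — THE CHAIN RULE: `D(P ∘ g)(x) v = (D_S P)(g x)` whenever `D gₐ(x) v = Sₐ(g x)` for all `a`;
* `ev_tderiv_eq_zero` — laws vanishing on an OPEN set have vanishing total derivatives there;
* `tderivWord`, `combine`, `derive` — iterated total derivatives along words of directions and the
  certificate interpreter; `ev_derive_eq_zero` (SOUNDNESS: every derived law vanishes on the open set);
* `cert_contradiction` — if a derived law and a «pin» polynomial `T` have `normalize (law ++ smul (−1) T) = []`
  (decidable) while `T(g(x₀)) ≠ 0` at some point of the set, `False`.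

Design: directions are indexed by `ℕ` with direction vectors `v : ℕ → E` and tables `S : ℕ → ℕ → QMvPoly`; unused directions
may be given `v j = 0`, `S j = fun _ => []` (the table hypothesis then holds trivially).  Hypothesis laws out of range of an
index are read as the zero polynomial (`List.getD … []`), which vanishes.  Tables must be POLYNOMIAL: when a principal
derivative has a RATIONAL normal form (division by a pin `π`, e.g. `1 − Λ` or the twist), adjoin a letter `ι` for `π⁻¹`
(a genuine analytic jet coordinate on a set where `π ≠ 0`) with the hypothesis law `π·ι − 1 = 0` and the table entry
`∂_v ι = −ι²·(D_S π)`; mixed partials of the unknowns are identified either by sorted multi-indices in the jet map or by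
adding the commutation laws `X_{xy…} − X_{yx…} = 0` as hypotheses.  Built for the exact-elimination certificates of the
Navier–Stokes poloidal-window programme but independent of it (a candidate for `Literature/Analysis/Calculus` once a cited form is
wanted; kept route-side because the statements are ours).

WHAT THIS IS NOT: not a claim about Navier–Stokes and not a certificate — the checker.  References: J. F. Ritt, *Differential Algebra* (1950), Ch. I; P. J. Olver, *Applications of Lie Groups to Differential Equations*
(1986), §2.3 eq. (2.12) (total derivative); the polynomial calculus is the tree's (`SparsePolynomialEnclosure`, Moore 1979 §3.4;
`MvPolynomialFDeriv`). [folklore]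
-/

noncomputable section

-- the summit and its single sub-problem share the name (CONVENTIONS §1), as in every Theorems file
set_option linter.dupNamespace false

namespace Summit.NavierStokesRegularity.NavierStokesRegularity.Theorems.PoloidalWindowDoorLrcModEntireJetCertDefs

open _root_.Topology _root_.Filter Set
open Literature.Analysis.ValidatedNumerics Literature.Analysis.ValidatedNumerics.QMvPoly
open Literature.Analysis.Calculus.MvPoly

/-! ### Evaluation and the total derivative -/

/-- The value of a term list `q` (in `n` letters) at the jet point `z ∈ ℝⁿ`. [folklore] -/
abbrev ev (n : ℕ) (q : QMvPoly) (z : EuclideanSpace ℝ (Fin n)) : ℝ :=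
  toFun (QMvPoly.toMv ℝ n q) z

/-- `ev` of a concatenation is the sum. [folklore] -/
theorem ev_append (n : ℕ) (p q : QMvPoly) (z : EuclideanSpace ℝ (Fin n)) :
    ev n (p ++ q) z = ev n p z + ev n q z := by
  simp [ev, QMvPoly.toMv_append]

/-- `ev` of a product is the product. [folklore] -/
theorem ev_mul (n : ℕ) (p q : QMvPoly) (z : EuclideanSpace ℝ (Fin n)) :
    ev n (QMvPoly.mul p q) z = ev n p z * ev n q z := by
  simp [ev, QMvPoly.toMv_mul]

/-- `ev` is unchanged by normalisation. [folklore] -/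
theorem ev_normalize (n : ℕ) (p : QMvPoly) (z : EuclideanSpace ℝ (Fin n)) :
    ev n (QMvPoly.normalize p) z = ev n p z := by
  simp [ev, QMvPoly.toMv_normalize]

/-- `ev` of a scalar multiple. [folklore] -/
theorem ev_smul (n : ℕ) (c : ℚ) (p : QMvPoly) (z : EuclideanSpace ℝ (Fin n)) :
    ev n (QMvPoly.smul c p) z = (c : ℝ) * ev n p z := by
  simp [ev, QMvPoly.toMv_smul]

/-- `ev` of the empty term list is `0`. [folklore] -/
@[simp] theorem ev_nil (n : ℕ) (z : EuclideanSpace ℝ (Fin n)) : ev n [] z = 0 := by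
  simp [ev]

/-- `ev` of a flattened list of term lists is the sum of the values. [folklore] -/
theorem ev_flatten (n : ℕ) (L : List QMvPoly) (z : EuclideanSpace ℝ (Fin n)) :
    ev n L.flatten z = (L.map fun q => ev n q z).sum := by
  induction L with
  | nil => simp
  | cons l L ih => rw [List.flatten_cons, ev_append, ih, List.map_cons, List.sum_cons]

/-- **THE TOTAL DERIVATIVE** of a term list `p` with respect to the derivative table `S` (the letter `a < n` has derivative
`S a`): `D_S p = Σ_{a<n} (∂p/∂X_a) · S a`. [folklore] -/
def tderiv (n : ℕ) (S : ℕ → QMvPoly) (p : QMvPoly) : QMvPoly :=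
  ((List.range n).map fun a => QMvPoly.mul (QMvPoly.pderivQ a p) (S a)).flatten

/-- List sums over `List.range n` are `Fin n`-indexed sums. [folklore] -/
theorem sum_map_range {M : Type*} [AddCommMonoid M] (f : ℕ → M) (n : ℕ) :
    ((List.range n).map f).sum = ∑ i : Fin n, f i := by
  induction n with
  | zero => simp
  | succ n ih => rw [List.range_succ, List.map_append, List.sum_append, ih, Fin.sum_univ_castSucc]; simp

/-- The polynomial meaning of the total derivative: `toMv (D_S p) = Σₐ ∂ₐ(toMv p) · toMv (S a)`. [folklore] -/
theorem toMv_tderiv (n : ℕ) (S : ℕ → QMvPoly) (p : QMvPoly) :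
    QMvPoly.toMv ℝ n (tderiv n S p) =
      ∑ a : Fin n, MvPolynomial.pderiv a (QMvPoly.toMv ℝ n p) * QMvPoly.toMv ℝ n (S a) := by
  rw [tderiv, QMvPoly.toMv_flatten, List.map_map]
  rw [show ((List.range n).map (QMvPoly.toMv ℝ n ∘ fun a => QMvPoly.mul (QMvPoly.pderivQ a p) (S a))).sum =
      ∑ a : Fin n, (QMvPoly.toMv ℝ n ∘ fun a => QMvPoly.mul (QMvPoly.pderivQ a p) (S a)) a from sum_map_range _ n]
  refine Finset.sum_congr rfl fun a _ => ?_
  simp only [Function.comp]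
  rw [QMvPoly.toMv_mul, QMvPoly.toMv_pderivQ]

/-! ### The chain rule in jet coordinates -/

variable {E : Type*} [NormedAddCommGroup E] [NormedSpace ℝ E] {n : ℕ}

/-- Components of the derivative of a `ℝⁿ`-valued map. [folklore] -/
theorem fderiv_apply_eq_fderiv_coord {g : E → EuclideanSpace ℝ (Fin n)} {x : E} (hg : DifferentiableAt ℝ g x)
    (v : E) (i : Fin n) : fderiv ℝ g x v i = fderiv ℝ (fun y => g y i) x v := by
  have h : (fun y => g y i) = (EuclideanSpace.proj i : EuclideanSpace ℝ (Fin n) →L[ℝ] ℝ) ∘ g := rfl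
  rw [h, fderiv_comp x (EuclideanSpace.proj i : EuclideanSpace ℝ (Fin n) →L[ℝ] ℝ).differentiableAt hg,
    ContinuousLinearMap.fderiv]
  rfl

/-- The derivative of a jet polynomial along a differentiable jet map: `D(P∘g)(x)v = Σᵢ D gᵢ(x)v · (∂ᵢP)(g x)`. [folklore] -/
theorem fderiv_ev_comp {g : E → EuclideanSpace ℝ (Fin n)} {x : E} (hg : DifferentiableAt ℝ g x) (p : QMvPoly) (v : E) :
    fderiv ℝ (fun y => ev n p (g y)) x v =
      ∑ i : Fin n, fderiv ℝ (fun y => g y i) x v * ev n (QMvPoly.pderivQ i p) (g x) := by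
  have h := (hasFDerivAt_toFun (QMvPoly.toMv ℝ n p) (g x)).comp x hg.hasFDerivAt
  rw [show (fun y => ev n p (g y)) = toFun (QMvPoly.toMv ℝ n p) ∘ g from rfl, h.fderiv,
    ContinuousLinearMap.comp_apply, derivCLM_apply]
  refine Finset.sum_congr rfl fun i _ => ?_
  rw [fderiv_apply_eq_fderiv_coord hg, ev, QMvPoly.toMv_pderivQ]

/-- **THE CHAIN RULE IN JET COORDINATES.**  If the jet map `g` is differentiable at `x` and each coordinate has
`D gᵢ(x) v = Sᵢ(g x)` (the derivative table `S` for the direction `v`), then for every jet polynomial `p`: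
`D(p ∘ g)(x) v = (D_S p)(g x)`. [folklore] -/
theorem fderiv_ev_eq_ev_tderiv {g : E → EuclideanSpace ℝ (Fin n)} {x v : E} {S : ℕ → QMvPoly}
    (hg : DifferentiableAt ℝ g x) (hS : ∀ i : Fin n, fderiv ℝ (fun y => g y i) x v = ev n (S i) (g x)) (p : QMvPoly) :
    fderiv ℝ (fun y => ev n p (g y)) x v = ev n (tderiv n S p) (g x) := by
  rw [fderiv_ev_comp hg, ev, toMv_tderiv, toFun_sum]
  refine Finset.sum_congr rfl fun i _ => ?_
  rw [hS i, toFun_mul, ev, ev, QMvPoly.toMv_pderivQ, mul_comm]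

/-- **Laws vanishing on an open set have vanishing total derivatives there.** [folklore] -/
theorem ev_tderiv_eq_zero {U : Set E} (hU : IsOpen U) {g : E → EuclideanSpace ℝ (Fin n)} {v : E} {S : ℕ → QMvPoly}
    (hg : ∀ x ∈ U, DifferentiableAt ℝ g x)
    (hS : ∀ x ∈ U, ∀ i : Fin n, fderiv ℝ (fun y => g y i) x v = ev n (S i) (g x))
    {L : QMvPoly} (hL : ∀ x ∈ U, ev n L (g x) = 0) : ∀ x ∈ U, ev n (tderiv n S L) (g x) = 0 := by
  intro x hx
  rw [← fderiv_ev_eq_ev_tderiv (hg x hx) (hS x hx)]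
  have hev : (fun y => ev n L (g y)) =ᶠ[𝓝 x] fun _ => (0 : ℝ) := by
    filter_upwards [hU.mem_nhds hx] with y hy using hL y hy
  rw [hev.fderiv_eq]
  simp

/-! ### Certificates -/

/-- Iterated total derivative along a word of directions (`j :: w` = first along `w`, then along direction `j`), with one
derivative table `S j` per direction `j`; normalised after every derivative to keep the term lists small. [folklore] -/
def tderivWord (n : ℕ) (S : ℕ → ℕ → QMvPoly) : List ℕ → QMvPoly → QMvPoly
  | [], p => p
  | j :: w, p => QMvPoly.normalize (tderiv n (S j) (tderivWord n S w p))

/-- One certificate step: the NORMALISED combination `Σₖ cₖ · D^{wₖ}(law_{iₖ})` of iterated total derivatives of already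
established laws (`laws.getD i []`: an out-of-range index reads the zero polynomial). [folklore] -/
def combine (n : ℕ) (S : ℕ → ℕ → QMvPoly) (laws : List QMvPoly) (step : List (QMvPoly × ℕ × List ℕ)) : QMvPoly :=
  QMvPoly.normalize ((step.map fun s => QMvPoly.mul s.1 (tderivWord n S s.2.2 (laws.getD s.2.1 []))).flatten)

/-- The certificate interpreter: starting from the hypothesis laws, append the combined law of each step. [folklore] -/
def derive (n : ℕ) (S : ℕ → ℕ → QMvPoly) : List QMvPoly → List (List (QMvPoly × ℕ × List ℕ)) → List QMvPoly
  | laws, [] => laws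
  | laws, step :: rest => derive n S (laws ++ [combine n S laws step]) rest

/-- Iterated total derivatives of a law vanishing on an open set vanish there. [folklore] -/
theorem ev_tderivWord_eq_zero {U : Set E} (hU : IsOpen U) {g : E → EuclideanSpace ℝ (Fin n)} {v : ℕ → E}
    {S : ℕ → ℕ → QMvPoly} (hg : ∀ x ∈ U, DifferentiableAt ℝ g x)
    (hS : ∀ j, ∀ x ∈ U, ∀ i : Fin n, fderiv ℝ (fun y => g y i) x (v j) = ev n (S j i) (g x))
    {L : QMvPoly} (hL : ∀ x ∈ U, ev n L (g x) = 0) (w : List ℕ) :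
    ∀ x ∈ U, ev n (tderivWord n S w L) (g x) = 0 := by
  induction w with
  | nil => simpa [tderivWord] using hL
  | cons j w ih =>
    intro x hx
    rw [tderivWord, ev_normalize]
    exact ev_tderiv_eq_zero hU hg (hS j) ih x hx

/-- A combination of vanishing laws vanishes. [folklore] -/
theorem ev_combine_eq_zero {U : Set E} (hU : IsOpen U) {g : E → EuclideanSpace ℝ (Fin n)} {v : ℕ → E}
    {S : ℕ → ℕ → QMvPoly} (hg : ∀ x ∈ U, DifferentiableAt ℝ g x)
    (hS : ∀ j, ∀ x ∈ U, ∀ i : Fin n, fderiv ℝ (fun y => g y i) x (v j) = ev n (S j i) (g x))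
    {laws : List QMvPoly} (hlaws : ∀ L ∈ laws, ∀ x ∈ U, ev n L (g x) = 0) (step : List (QMvPoly × ℕ × List ℕ)) :
    ∀ x ∈ U, ev n (combine n S laws step) (g x) = 0 := by
  intro x hx
  rw [combine, ev_normalize, ev_flatten, List.map_map]
  refine List.sum_eq_zero fun r hr => ?_
  obtain ⟨s, -, rfl⟩ := List.mem_map.1 hr
  have hsrc : ∀ y ∈ U, ev n (laws.getD s.2.1 []) (g y) = 0 := by
    intro y hy
    rw [List.getD_eq_getElem?_getD]
    cases h : laws[s.2.1]? with
    | none => simp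
    | some L => simpa using hlaws L (List.mem_of_getElem? h) y hy
  simp only [Function.comp, ev_mul]
  rw [ev_tderivWord_eq_zero hU hg hS hsrc s.2.2 x hx, mul_zero]

/-- **SOUNDNESS OF THE CERTIFICATE INTERPRETER.**  On an open set `U`, along a differentiable jet map `g` closed under the
directions `v j` with tables `S j`: if every hypothesis law vanishes on `U`, so does every derived law. [folklore] -/
theorem ev_derive_eq_zero {U : Set E} (hU : IsOpen U) {g : E → EuclideanSpace ℝ (Fin n)} {v : ℕ → E}
    {S : ℕ → ℕ → QMvPoly} (hg : ∀ x ∈ U, DifferentiableAt ℝ g x)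
    (hS : ∀ j, ∀ x ∈ U, ∀ i : Fin n, fderiv ℝ (fun y => g y i) x (v j) = ev n (S j i) (g x))
    (cert : List (List (QMvPoly × ℕ × List ℕ))) :
    ∀ laws : List QMvPoly, (∀ L ∈ laws, ∀ x ∈ U, ev n L (g x) = 0) →
      ∀ L ∈ derive n S laws cert, ∀ x ∈ U, ev n L (g x) = 0 := by
  induction cert with
  | nil => intro laws hlaws; simpa [derive] using hlaws
  | cons step rest ih =>
    intro laws hlaws
    rw [derive]
    refine ih _ fun L hL => ?_
    rcases List.mem_append.1 hL with h | h
    · exact hlaws L h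
    · rw [List.mem_singleton.1 h]
      exact ev_combine_eq_zero hU hg hS hlaws step

/-- **CONTRADICTION FROM A CERTIFICATE.**  If the `k`-th derived law agrees with a «pin» polynomial `T`
(`normalize (law ++ smul (−1) T) = []`, a decidable syntactic check) and `T(g(x₀)) ≠ 0` at a point `x₀ ∈ U`, then the
hypothesis laws cannot all vanish on `U`. [folklore] -/
theorem cert_contradiction {U : Set E} (hU : IsOpen U) {g : E → EuclideanSpace ℝ (Fin n)} {v : ℕ → E}
    {S : ℕ → ℕ → QMvPoly} (hg : ∀ x ∈ U, DifferentiableAt ℝ g x)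
    (hS : ∀ j, ∀ x ∈ U, ∀ i : Fin n, fderiv ℝ (fun y => g y i) x (v j) = ev n (S j i) (g x))
    {hyps : List QMvPoly} (hhyps : ∀ L ∈ hyps, ∀ x ∈ U, ev n L (g x) = 0)
    (cert : List (List (QMvPoly × ℕ × List ℕ))) (k : ℕ) (T : QMvPoly)
    (hk : QMvPoly.normalize ((derive n S hyps cert).getD k [] ++ QMvPoly.smul (-1) T) = [])
    {x₀ : E} (hx₀ : x₀ ∈ U) (hT : ev n T (g x₀) ≠ 0) : False := by
  apply hT
  -- the k-th derived law vanishes at x₀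
  have hlaw : ev n ((derive n S hyps cert).getD k []) (g x₀) = 0 := by
    rw [List.getD_eq_getElem?_getD]
    cases h : (derive n S hyps cert)[k]? with
    | none => simp
    | some L => simpa using ev_derive_eq_zero hU hg hS cert hyps hhyps L (List.mem_of_getElem? h) x₀ hx₀
  -- the syntactic check says `law − T ≡ 0`
  have hdiff : ev n ((derive n S hyps cert).getD k [] ++ QMvPoly.smul (-1) T) (g x₀) = 0 := by
    rw [← ev_normalize, hk, ev_nil]
  rw [ev_append, ev_smul, hlaw] at hdiff
  simpa using hdiff

/-! ### A worked micro-example (self-test of the interpreter, checked by `decide`)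

Two letters `X₀ = u`, `X₁ = u′` for a function `u` of one variable with `u″ = u` (direction `0`: table `X₀ ↦ X₁`, `X₁ ↦ X₀`),
hypothesis law `u′ − 2u = 0`.  Step 1 differentiates it (`u − 2u′`), step 2 forms `−(1/3)(law₁ + 2·law₀) = u`: the derived law
number `2` (after the hypothesis `0` and step-1 law `1`) is the pin `X₀`, so `u ≡ 0` — `u(x₀) ≠ 0` is contradictory. -/

/-- The derivative table of the micro-example. [folklore] -/
def exampleTable : ℕ → ℕ → QMvPoly :=
  fun j a => if j = 0 then (if a = 0 then QMvPoly.var 2 1 else if a = 1 then QMvPoly.var 2 0 else []) else []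

/-- The micro-example's certificate closes syntactically (kernel `decide`). [folklore] -/
theorem example_check :
    QMvPoly.normalize ((derive 2 exampleTable [QMvPoly.var 2 1 ++ QMvPoly.smul (-2) (QMvPoly.var 2 0)]
        [[(QMvPoly.const 1, 0, [0])],
         [(QMvPoly.const (-1/3), 1, []), (QMvPoly.const (-2/3), 0, [])]]).getD 2 []
      ++ QMvPoly.smul (-1) (QMvPoly.var 2 0)) = [] := by
  decide +kernel

end Summit.NavierStokesRegularity.NavierStokesRegularity.Theorems.PoloidalWindowDoorLrcModEntireJetCertDefs

end
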